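import Summits.QuantumFields.GaugeBoot.BootstrapCertificatesSuN
import Summits.QuantumFields.GaugeBoot.StrongCouplingOrderSuN
import HarnessLib

/-!
# Transport of certificates in the coupling: a level-`n` certificate at `β` certifies `P ≤ c + C|β' − β|` at every `β'`; the SDP bounds are semicontinuous in `β` (gauge-boot, L1/L4 supplement)

HONEST FRAMING (cell `pub-gaugeboot`, page 1 of every file): the venture produces certified bounds
on lattice expectations at stated coupling, gauge group, dimension and torus size; NOT a mass gap,
NOT a continuum limit, NOT a string tension; NOT Yang–Mills-summit-bearing (barriers
`FixedCouplingUltralocality`, `PerturbativeInvisibility`). Structural; the constant `C` below is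
not computed and no number is certified.

## Content

A level-`n` certificate `c • 1 - P = σ + Σ_l λ_l (f_l' - β f_l S_l')` at coupling `β` depends on
`β` only through the row elements, and `f' - β f S' = (f' - β' f S') + (β' - β) f S'`. The
remainder `R = Σ_l λ_l f_l S_l'` is a combination of words of length `≤ n + 4 ≤ 2n` (`n ≥ 4`, the
action derivatives being words of length `4`), so by the archimedean property
(`BootstrapArchimedean`) `C • 1 ± R` are sums of squares of level-`n` test functions for some
`C ≥ 0` which does not depend on `β'`. Hence:

* ★★ `certificate_transport` (any lattice; actions whose shift derivatives are words of length
  `≤ 4`; `n ≥ 4`) — `c • 1 - P ∈ certCone β` gives `C ≥ 0` with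
  `(c + C |β' - β|) • 1 - P ∈ certCone β'` for EVERY real `β'`;
  `exists_forall_feasible_apply_le_of_mem_certCone` — so every level-`n` feasible functional at
  `β'` has `φ P ≤ c + C |β' - β|`;
* ★★ `wilson_le_transport_suN` — `SU(N)` torus: a level-`n` certificate for `P ≤ c` at `β` proves
  `∫ P dμ_{β'} ≤ c + C |β' - β|` at every `β'` (a certified grid in `β` gives a certified band);
* ★★ `upperSemicontinuous_sSup_levelValues_suN` / `lowerSemicontinuous_sInf_levelValues_suN` —
  the level-`n` SDP upper bound of `P` is upper semicontinuous in `β` and the lower bound lower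
  semicontinuous (completeness at `β` + transport).

References: the cell's MonotoneEnvelope (transport of bounds in `β` for the monotone mean
plaquette); Josz–Henrion (2016). Folklore.
-/

noncomputable section

open MeasureTheory Filter Topology NormedSpace
open Literature.MathematicalPhysics.QuantumFieldTheory (LatticeRep Edge GaugeConfig wilsonAction
  wilsonMeasure isProbabilityMeasure_wilsonMeasure)
open Literature.MathematicalPhysics.QuantumLattice

namespace Summit.QuantumFields.GaugeBoot

open OrderUnitDuality

/-! ## Rows at two couplings -/

section General

variable {ι : Type*} [DecidableEq ι] {G : Type*} [Group G] [TopologicalSpace G] (r : LatticeRep G)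
  {K : Type*} (k : K → ℝ → G) (S : ι → (ι → G) → ℝ)

/-- **The action products** `f S_i'`: a test function times a polynomial shift derivative of a
local action — the `β`-coefficient of a row element. [folklore] -/
def actionMulSet (V : Set C(ι → G, ℝ)) : Set C(ι → G, ℝ) :=
  {x | ∃ (i : ι) (a : K) (f S' : C(ι → G, ℝ)), f ∈ V ∧ S' ∈ polyAlgebra (ι := ι) r ∧
    (∀ U, HasDerivAt (fun t => S i (Function.update U i (k a t * U i))) (S' U) 0) ∧ f * S' = x}

variable {k S}

/-- ★ **Rows at `β` versus rows at `β'`**: every `ρ` in the row space at `β` has a remainder `R`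
(a combination of action products, independent of `β'`) with `ρ - (β' - β) • R` in the row space
at `β'` for EVERY `β'`. [folklore] -/
theorem exists_remainder_of_mem_rowSpace {V : Set C(ι → G, ℝ)} {β : ℝ} {ρ : C(ι → G, ℝ)}
    (hρ : ρ ∈ rowSpace r k S β V) :
    ∃ R ∈ Submodule.span ℝ (actionMulSet r k S V),
      ∀ β' : ℝ, ρ - (β' - β) • R ∈ rowSpace r k S β' V := by
  induction hρ using Submodule.span_induction with
  | mem x hx =>
    obtain ⟨i, a, f, f', S', hf, hf', hS', hS'd, hf'd, rfl⟩ := hx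
    refine ⟨f * S', Submodule.subset_span ⟨i, a, f, S', hf, hS', hS'd, rfl⟩, fun β' => ?_⟩
    have h : f' - β • (f * S') - (β' - β) • (f * S') = f' - β' • (f * S') := by
      rw [sub_smul]; abel
    rw [h]
    exact Submodule.subset_span ⟨i, a, f, f', S', hf, hf', hS', hS'd, hf'd, rfl⟩
  | zero => exact ⟨0, Submodule.zero_mem _, fun β' => by rw [smul_zero, sub_zero]; exact Submodule.zero_mem _⟩
  | add x y _ _ hx hy =>
    obtain ⟨R₁, hR₁, h₁⟩ := hx
    obtain ⟨R₂, hR₂, h₂⟩ := hy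
    refine ⟨R₁ + R₂, Submodule.add_mem _ hR₁ hR₂, fun β' => ?_⟩
    have h : x + y - (β' - β) • (R₁ + R₂) = (x - (β' - β) • R₁) + (y - (β' - β) • R₂) := by
      rw [smul_add]; abel
    rw [h]
    exact Submodule.add_mem _ (h₁ β') (h₂ β')
  | smul c x _ hx =>
    obtain ⟨R, hR, h⟩ := hx
    refine ⟨c • R, Submodule.smul_mem _ c hR, fun β' => ?_⟩
    have h' : c • x - (β' - β) • (c • R) = c • (x - (β' - β) • R) := by
      rw [smul_sub, smul_comm c (β' - β) R]
    rw [h']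
    exact Submodule.smul_mem _ c (h β')

/-- **Action products are words of length `≤ 2n`** when the test functions have length `≤ n`,
the action derivatives length `≤ 4`, and `n ≥ 4`. -/
theorem actionMulSet_subset_wordTruncation {n : ℕ} (hn : 4 ≤ n)
    (hS4 : ∀ (i : ι) (a : K), ∃ S' ∈ wordTruncation (ι := ι) r 4,
      ∀ U, HasDerivAt (fun t => S i (Function.update U i (k a t * U i))) (S' U) 0) :
    actionMulSet r k S (wordTruncation (ι := ι) r n) ⊆ wordTruncation (ι := ι) r (n + n) := by
  rintro x ⟨i, a, f, S', hf, -, hS'd, rfl⟩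
  obtain ⟨S₀, hS₀, hS₀d⟩ := hS4 i a
  have he : S' = S₀ := ContinuousMap.ext fun U => (hS'd U).unique (hS₀d U)
  rw [he]
  exact wordTruncation_mono r (by omega) (mul_mem_wordTruncation_add r hf hS₀)

omit [DecidableEq ι] in
/-- **A uniform archimedean bound**: every combination of words of length `≤ 2n` is within a
non-negative multiple of `1` of `0` in the SOS order of level `n`, from both sides. -/
theorem exists_nonneg_smul_one_sub_add_mem_sosCone {n : ℕ} {x : C(ι → G, ℝ)}
    (hx : x ∈ Submodule.span ℝ (wordsUpTo (ι := ι) r (n + n))) :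
    ∃ t : ℝ, 0 ≤ t ∧ t • (1 : C(ι → G, ℝ)) - x ∈ sosCone (wordTruncation (ι := ι) r n) ∧
      t • (1 : C(ι → G, ℝ)) + x ∈ sosCone (wordTruncation (ι := ι) r n) := by
  have hgen : ∀ w ∈ wordsUpTo (ι := ι) r (n + n),
      (∃ t : ℝ, t • (1 : C(ι → G, ℝ)) - w ∈ sosCone (wordTruncation (ι := ι) r n)) ∧
        ∃ t : ℝ, t • (1 : C(ι → G, ℝ)) + w ∈ sosCone (wordTruncation (ι := ι) r n) := by
    intro w hw
    obtain ⟨hm, hp⟩ := one_sub_mem_sosCone_and r hw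
    exact ⟨⟨1, by rwa [one_smul]⟩, ⟨1, by rwa [one_smul]⟩⟩
  obtain ⟨⟨t₁, h₁⟩, ⟨t₂, h₂⟩⟩ := exists_smul_one_sub_mem_of_mem_span
    (Kc := sosCone (wordTruncation (ι := ι) r n)) hgen hx
  have h11 : (1 : C(ι → G, ℝ)) * 1 ∈ sosCone (wordTruncation (ι := ι) r n) :=
    mul_self_mem_sosCone (one_mem_wordTruncation r n)
  rw [mul_one] at h11
  refine ⟨max (max t₁ t₂) 0, le_max_right _ _, ?_, ?_⟩
  · have h : max (max t₁ t₂) 0 • (1 : C(ι → G, ℝ)) - x =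
        (t₁ • 1 - x) + (max (max t₁ t₂) 0 - t₁) • (1 : C(ι → G, ℝ)) := by
      rw [sub_smul]; abel
    rw [h]
    exact Submodule.add_mem _ h₁ (smul_mem_of_nonneg
      (sub_nonneg.2 ((le_max_left _ _).trans (le_max_left _ _))) h11)
  · have h : max (max t₁ t₂) 0 • (1 : C(ι → G, ℝ)) + x =
        (t₂ • 1 + x) + (max (max t₁ t₂) 0 - t₂) • (1 : C(ι → G, ℝ)) := by
      rw [sub_smul]; abel
    rw [h]
    exact Submodule.add_mem _ h₂ (smul_mem_of_nonneg
      (sub_nonneg.2 ((le_max_right _ _).trans (le_max_left _ _))) h11)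

/-- ★★ **Transport of certificates in `β`.** Local actions whose shift derivatives are test
functions of length `≤ 4`, level `n ≥ 4`: a level-`n` certificate `c • 1 - P ∈ certCone β` yields
a constant `C ≥ 0` such that `(c + C |β' - β|) • 1 - P ∈ certCone β'` for EVERY real `β'` — the
same SOS part, the rows rewritten at `β'`, and the remainder absorbed by the archimedean property.
[folklore] -/
theorem certificate_transport {n : ℕ} (hn : 4 ≤ n)
    (hS4 : ∀ (i : ι) (a : K), ∃ S' ∈ wordTruncation (ι := ι) r 4,
      ∀ U, HasDerivAt (fun t => S i (Function.update U i (k a t * U i))) (S' U) 0)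
    {β : ℝ} {P : C(ι → G, ℝ)} {c : ℝ}
    (hc : c • (1 : C(ι → G, ℝ)) - P ∈ certCone r k S β (wordTruncation (ι := ι) r n)) :
    ∃ C : ℝ, 0 ≤ C ∧ ∀ β' : ℝ,
      (c + C * |β' - β|) • (1 : C(ι → G, ℝ)) - P ∈ certCone r k S β' (wordTruncation (ι := ι) r n) := by
  obtain ⟨σ, hσ, ρ, hρ, hcert⟩ := (mem_certCone_iff r).1 hc
  obtain ⟨R, hR, hρ'⟩ := exists_remainder_of_mem_rowSpace r hρ
  have hR' : R ∈ Submodule.span ℝ (wordsUpTo (ι := ι) r (n + n)) :=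
    (Submodule.span_le.2 (actionMulSet_subset_wordTruncation r hn hS4)) hR
  obtain ⟨C, hC0, hCm, hCp⟩ := exists_nonneg_smul_one_sub_add_mem_sosCone r hR'
  refine ⟨C, hC0, fun β' => ?_⟩
  -- `(c + C|β'-β|) 1 - P = σ + (ρ - (β'-β) R) + ((β'-β) R + C|β'-β| 1)`
  have hP' : P = c • (1 : C(ι → G, ℝ)) - (σ + ρ) := by rw [hcert]; abel
  have hsplit : (c + C * |β' - β|) • (1 : C(ι → G, ℝ)) - P =
      (σ + (ρ - (β' - β) • R)) + ((β' - β) • R + (C * |β' - β|) • (1 : C(ι → G, ℝ))) := by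
    rw [hP']
    ext U
    simp only [ContinuousMap.sub_apply, ContinuousMap.add_apply, ContinuousMap.smul_apply,
      ContinuousMap.one_apply, smul_eq_mul]
    ring
  rw [hsplit]
  refine Submodule.add_mem _ (Submodule.add_mem _ (sosCone_le_certCone r hσ)
    (mem_certCone_of_mem_rowSpace r (hρ' β'))) (sosCone_le_certCone r ?_)
  rcases le_or_gt β β' with hle | hlt
  · have h : (β' - β) • R + (C * |β' - β|) • (1 : C(ι → G, ℝ)) = (β' - β) • (C • 1 + R) := by
      rw [abs_of_nonneg (sub_nonneg.2 hle)]
      ext U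
      simp only [ContinuousMap.add_apply, ContinuousMap.smul_apply, ContinuousMap.one_apply,
        smul_eq_mul]
      ring
    rw [h]
    exact smul_mem_of_nonneg (sub_nonneg.2 hle) hCp
  · have h : (β' - β) • R + (C * |β' - β|) • (1 : C(ι → G, ℝ)) = (β - β') • (C • 1 - R) := by
      rw [abs_of_neg (sub_neg.2 hlt)]
      ext U
      simp only [ContinuousMap.sub_apply, ContinuousMap.add_apply, ContinuousMap.smul_apply,
        ContinuousMap.one_apply, smul_eq_mul]
      ring
    rw [h]
    exact smul_mem_of_nonneg (sub_nonneg.2 hlt.le) hCm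

end General

section Feasible

variable {ι : Type*} [DecidableEq ι] [Countable ι] {G : Type*} [Group G] [TopologicalSpace G]
  [IsTopologicalGroup G] [CompactSpace G] [MeasurableSpace G] [BorelSpace G]
  [SecondCountableTopology G] (r : LatticeRep G) {K : Type*}
  {k : K → ℝ → G} {S : ι → (ι → G) → ℝ}

omit [Countable ι] [IsTopologicalGroup G] [CompactSpace G] [MeasurableSpace G] [BorelSpace G]
  [SecondCountableTopology G] in
/-- ★★ **A certificate at `β` bounds the feasible values at every `β'`, with linear loss.**
[folklore] -/
theorem exists_forall_feasible_apply_le_of_mem_certCone {n : ℕ} (hn : 4 ≤ n)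
    (hS4 : ∀ (i : ι) (a : K), ∃ S' ∈ wordTruncation (ι := ι) r 4,
      ∀ U, HasDerivAt (fun t => S i (Function.update U i (k a t * U i))) (S' U) 0)
    {β : ℝ} {P : C(ι → G, ℝ)} {c : ℝ}
    (hc : c • (1 : C(ι → G, ℝ)) - P ∈ certCone r k S β (wordTruncation (ι := ι) r n)) :
    ∃ C : ℝ, 0 ≤ C ∧ ∀ (β' : ℝ) (φ : C(ι → G, ℝ) →ₗ[ℝ] ℝ),
      IsBootstrapFeasible r k S β' (wordTruncation (ι := ι) r n) φ → φ P ≤ c + C * |β' - β| := by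
  obtain ⟨C, hC0, hC⟩ := certificate_transport r hn hS4 hc
  exact ⟨C, hC0, fun β' φ hφ => hφ.apply_le_of_mem_certCone r (hC β')⟩

end Feasible

/-! ## `SU(N)` on the torus -/

section SuN

variable {d L : ℕ} [NeZero L] (N : ℕ)

/-- The shift derivatives of the `SU(N)` Wilson action are test functions of word length `≤ 4`. -/
theorem wilsonAction_deriv_wordTruncation_four_suN (i : Edge d L) (a : SuGenerator N) :
    ∃ S' ∈ wordTruncation (ι := Edge d L) (fundamentalLatticeRep N) 4,
      ∀ U : GaugeConfig d L (Matrix.specialUnitaryGroup (Fin N) ℂ),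
        HasDerivAt (fun t => wilsonAction (fundamentalRep (Fin N))
          (Function.update U i (suExp N a t * U i))) (S' U) 0 :=
  ⟨torusActionDeriv (fundamentalLatticeRep N) (suExp N) i a,
    mem_wordTruncation_of_mem_wordSpace _ (torusActionDeriv_mem (fundamentalLatticeRep N)
      (suExp_add N) (X := fun X : SuGenerator N => (X : Matrix (Fin N) (Fin N) ℂ)) (rho_suExp N) i a),
    fun U => hasDerivAt_torusActionDeriv (fundamentalLatticeRep N) (suExp_add N)
      (X := fun X : SuGenerator N => (X : Matrix (Fin N) (Fin N) ℂ)) (rho_suExp N) i a U⟩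

/-- ★★ **Transport of `SU(N)` torus certificates in `β`**: a level-`n` certificate (`n ≥ 4`) for
`P ≤ c` at `β` yields `C ≥ 0` with a level-`n` certificate for `P ≤ c + C |β' - β|` at every `β'`.
[folklore] -/
theorem certificate_transport_suN {n : ℕ} (hn : 4 ≤ n) {β : ℝ}
    {P : C(GaugeConfig d L (Matrix.specialUnitaryGroup (Fin N) ℂ), ℝ)} {c : ℝ}
    (hc : c • (1 : C(GaugeConfig d L (Matrix.specialUnitaryGroup (Fin N) ℂ), ℝ)) - P ∈
      certConeSuN (d := d) (L := L) N β n) :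
    ∃ C : ℝ, 0 ≤ C ∧ ∀ β' : ℝ,
      (c + C * |β' - β|) • (1 : C(GaugeConfig d L (Matrix.specialUnitaryGroup (Fin N) ℂ), ℝ)) - P ∈
        certConeSuN (d := d) (L := L) N β' n :=
  certificate_transport (fundamentalLatticeRep N) hn (wilsonAction_deriv_wordTruncation_four_suN N) hc

/-- ★★ **A certificate at `β` bounds the Wilson expectation at EVERY `β'`**:
`∫ P dμ_{β'} ≤ c + C |β' - β|` (and every level-`n` feasible value at `β'`). [folklore] -/
theorem wilson_le_transport_suN {n : ℕ} (hn : 4 ≤ n) {β : ℝ}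
    {P : C(GaugeConfig d L (Matrix.specialUnitaryGroup (Fin N) ℂ), ℝ)} {c : ℝ}
    (hc : c • (1 : C(GaugeConfig d L (Matrix.specialUnitaryGroup (Fin N) ℂ), ℝ)) - P ∈
      certConeSuN (d := d) (L := L) N β n) :
    ∃ C : ℝ, 0 ≤ C ∧ ∀ β' : ℝ,
      (∀ t ∈ levelValuesSuN (d := d) (L := L) N β' n P, t ≤ c + C * |β' - β|) ∧
        ∫ U, P U ∂(wilsonMeasure (fundamentalRep (Fin N)) β') ≤ c + C * |β' - β| := by
  obtain ⟨C, hC0, hC⟩ := certificate_transport_suN N hn hc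
  exact ⟨C, hC0, fun β' => ⟨levelValues_le_of_mem_certCone_suN N β' (hC β'),
    wilson_le_of_mem_certCone_suN N β' (hC β')⟩⟩

/-- ★★ **The level-`n` SDP upper bound is upper semicontinuous in `β`** (`n ≥ 4`, `P` in the
certificate domain): completeness at `β` gives a certificate for `hi(β) + ε`, transport gives
`hi(β') ≤ hi(β) + ε + C|β' - β|`. [folklore] -/
theorem upperSemicontinuous_sSup_levelValues_suN {n : ℕ} (hn : 4 ≤ n)
    {P : C(GaugeConfig d L (Matrix.specialUnitaryGroup (Fin N) ℂ), ℝ)}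
    (hP : ∀ β : ℝ, P ∈ certDomainSuN (d := d) (L := L) N β n) :
    UpperSemicontinuous fun β : ℝ => sSup (levelValuesSuN (d := d) (L := L) N β n P) := by
  intro β y hy
  dsimp only at hy
  obtain ⟨lo, hi, hIcc, hW⟩ := levelValues_eq_Icc_suN N β (hP β)
  have hsup : sSup (levelValuesSuN (d := d) (L := L) N β n P) = hi := by
    rw [hIcc]; exact csSup_Icc (hW.1.trans hW.2)
  rw [hsup] at hy
  set ε := (y - hi) / 3 with hε
  have hε0 : 0 < ε := by rw [hε]; linarith
  -- a certificate for `hi + ε` at `β`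
  have hle : ∀ t ∈ levelValuesSuN (d := d) (L := L) N β n P, t ≤ hi := fun t ht => by
    rw [hIcc] at ht; exact ht.2
  obtain ⟨σ, hσ, ρ, hρ, hcert⟩ := exists_certificate_suN N β (hP β) hle (lt_add_of_pos_right hi hε0)
  have hc : (hi + ε) • (1 : C(GaugeConfig d L (Matrix.specialUnitaryGroup (Fin N) ℂ), ℝ)) - P ∈
      certConeSuN (d := d) (L := L) N β n := by
    rw [← hcert]; exact (mem_certCone_iff _).2 ⟨σ, hσ, ρ, hρ, rfl⟩
  obtain ⟨C, hC0, hC⟩ := certificate_transport_suN N hn hc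
  -- near `β` the transported bound is below `y`
  have hδ : 0 < ε / (C + 1) := div_pos hε0 (by linarith)
  filter_upwards [Metric.ball_mem_nhds β hδ] with β' hβ'
  rw [Metric.mem_ball, Real.dist_eq] at hβ'
  obtain ⟨lo', hi', hIcc', hW'⟩ := levelValues_eq_Icc_suN N β' (hP β')
  have hsup' : sSup (levelValuesSuN (d := d) (L := L) N β' n P) = hi' := by
    rw [hIcc']; exact csSup_Icc (hW'.1.trans hW'.2)
  have hhi' : hi' ∈ levelValuesSuN (d := d) (L := L) N β' n P := by
    rw [hIcc']; exact Set.right_mem_Icc.2 (hW'.1.trans hW'.2)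
  have h1 := levelValues_le_of_mem_certCone_suN N β' (hC β') hi' hhi'
  have h2 : C * |β' - β| ≤ ε := by
    have h3 : C * |β' - β| ≤ (C + 1) * (ε / (C + 1)) :=
      mul_le_mul (by linarith) hβ'.le (abs_nonneg _) (by linarith)
    rwa [mul_div_cancel₀ _ (by linarith : (C + 1) ≠ 0)] at h3
  show sSup (levelValuesSuN (d := d) (L := L) N β' n P) < y
  rw [hsup']
  linarith

/-- ★★ **The level-`n` SDP lower bound is lower semicontinuous in `β`.** [folklore] -/
theorem lowerSemicontinuous_sInf_levelValues_suN {n : ℕ} (hn : 4 ≤ n)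
    {P : C(GaugeConfig d L (Matrix.specialUnitaryGroup (Fin N) ℂ), ℝ)}
    (hP : ∀ β : ℝ, P ∈ certDomainSuN (d := d) (L := L) N β n) :
    LowerSemicontinuous fun β : ℝ => sInf (levelValuesSuN (d := d) (L := L) N β n P) := by
  intro β y hy
  dsimp only at hy
  obtain ⟨lo, hi, hIcc, hW⟩ := levelValues_eq_Icc_suN N β (hP β)
  have hinf : sInf (levelValuesSuN (d := d) (L := L) N β n P) = lo := by
    rw [hIcc]; exact csInf_Icc (hW.1.trans hW.2)
  rw [hinf] at hy
  set ε := (lo - y) / 3 with hε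
  have hε0 : 0 < ε := by rw [hε]; linarith
  have hge : ∀ t ∈ levelValuesSuN (d := d) (L := L) N β n P, lo ≤ t := fun t ht => by
    rw [hIcc] at ht; exact ht.1
  obtain ⟨σ, hσ, ρ, hρ, hcert⟩ := exists_lower_certificate_suN N β (hP β) hge (sub_lt_self lo hε0)
  -- a lower certificate for `P ≥ lo - ε` is an upper certificate for `-P ≤ -(lo - ε)`
  have hc : (-(lo - ε)) • (1 : C(GaugeConfig d L (Matrix.specialUnitaryGroup (Fin N) ℂ), ℝ)) - (-P) ∈
      certConeSuN (d := d) (L := L) N β n := by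
    have h : (-(lo - ε)) • (1 : C(GaugeConfig d L (Matrix.specialUnitaryGroup (Fin N) ℂ), ℝ)) - (-P) =
        P - (lo - ε) • 1 := by rw [neg_smul]; abel
    rw [h, ← hcert]; exact (mem_certCone_iff _).2 ⟨σ, hσ, ρ, hρ, rfl⟩
  obtain ⟨C, hC0, hC⟩ := certificate_transport_suN N hn hc
  have hδ : 0 < ε / (C + 1) := div_pos hε0 (by linarith)
  filter_upwards [Metric.ball_mem_nhds β hδ] with β' hβ'
  rw [Metric.mem_ball, Real.dist_eq] at hβ'
  obtain ⟨lo', hi', hIcc', hW'⟩ := levelValues_eq_Icc_suN N β' (hP β')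
  have hinf' : sInf (levelValuesSuN (d := d) (L := L) N β' n P) = lo' := by
    rw [hIcc']; exact csInf_Icc (hW'.1.trans hW'.2)
  have hlo' : lo' ∈ levelValuesSuN (d := d) (L := L) N β' n P := by
    rw [hIcc']; exact Set.left_mem_Icc.2 (hW'.1.trans hW'.2)
  obtain ⟨φ, hφ, hφP⟩ := hlo'
  have h1 : φ (-P) ≤ -(lo - ε) + C * |β' - β| := hφ.apply_le_of_mem_certCone _ (hC β')
  rw [map_neg, hφP] at h1
  have h2 : C * |β' - β| ≤ ε := by
    have h3 : C * |β' - β| ≤ (C + 1) * (ε / (C + 1)) :=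
      mul_le_mul (by linarith) hβ'.le (abs_nonneg _) (by linarith)
    rwa [mul_div_cancel₀ _ (by linarith : (C + 1) ≠ 0)] at h3
  show y < sInf (levelValuesSuN (d := d) (L := L) N β' n P)
  rw [hinf']
  linarith

end SuN

end Summit.QuantumFields.GaugeBoot

end
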